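import Literature.Geometry.Kaehler.ComplexTorusIntersectionRing
import HarnessLib

/-!
# Intersection numbers in the intersection ring of a complex torus: graded symmetry,
# `(λ_T · {D}^{·q}) = (-1)^q q! ∏_{ν∈T} d_ν`, and `(C · Θ) = g` (Lange 2023, §2.5.3, §4.2)

Layer `Literature/Geometry/Kaehler`, namespace `Literature.Geometry.Kaehler.ComplexTorus`; lane
`lit-hodgefound`, Layer A4, row **A4-31⁺⁺ FILE 2** (prover seat `lit-hodgefound-p09`): theorems-only
sequel of `ComplexTorusIntersectionRing.lean` (`intersectionProduct`, `intersectionPow`, `pontryaginPow`,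
Thm. 2.5.16 as an intersection power, the curve class `-Σ_ν d_ν λ_ν ⋆ μ_ν` from its periods) and of
`ComplexTorusPoincareFormula.lean` (`intersectionNumber (σ · τ) = ∫_X P σ ∧ P τ`, Lemma 2.5.15).

Source followed: H. Lange, *Abelian Varieties over the Complex Numbers* (2023), held copy
`book:lange1992-complex-abelian-varieties`: §2.5.3 p0134 (intersection numbers), Lemma 2.5.15
"`(λᵢ ⋆ λⱼ · {D}) = -dᵢ δ_{g+i,j}`", Thm. 2.5.16; §4.2 p0204 **Corollary 4.2.3** "`(C · Θ) = g`" (there from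
Poincaré's formula `[C] ∧ [Θ] = (1/(g-1)!) ∧^g [Θ]` and Riemann–Roch; here, for the class with the periods
of `C`, directly from Lemma 2.5.15).

## Contents (theorems only; no definition, no named fact)

* `intersectionNumber_comm` — **`(τ · σ) = (-1)^{kl} (σ · τ)`** (`σ ∈ H_k`, `τ ∈ H_l`, `k + l = 2g`);
* `IsSymplecticEnum.intersectionNumber_latCycle_ilvWord_intersectionPow` —
  **`(λ_{t₁} ⋆ μ_{t₁} ⋆ ⋯ ⋆ λ_{t_q} ⋆ μ_{t_q} · {D}^{·q}) = (-1)^q q! ∏ᵢ d_{tᵢ}`** for a symplectic enumeration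
  of type `d` (Lemma 2.5.15 is `q = 1`);
* `IsSymplecticEnum.intersectionNumber_neg_sum_smul_latCycle_pair_divisorCycle` —
  `(-Σ_ν d_ν λ_ν ⋆ μ_ν · {D}) = Σ_ν d_ν²`;
* `IsSymplecticEnum.intersectionNumber_divisorCycle_eq_of_cycleIntegral` — **Cor. 4.2.3 at torus level**:
  for a principal polarisation and any `W ∈ H₂(X, ℤ)` with the periods of the curve class
  (`∫_W dx_a ∧ dx_b = -E(λ_a, λ_b)`), `(W · {Θ}) = g`.

## References

* [Lange2023AbelianVarietiesComplex] H. Lange, *Abelian Varieties over the Complex Numbers*,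
  Grundlehren Text Editions, Springer (2023), §2.5.3 p. 134, Lemma 2.5.15, Thm. 2.5.16; §4.2 Cor. 4.2.3.
* [GriffithsHarris1978] P. Griffiths, J. Harris, *Principles of Algebraic Geometry* (1978), Ch. 0 §4.
-/

noncomputable section

open scoped Manifold ContDiff Topology
open Set Function Complex Finset
open Literature.LinearAlgebra.Alternating

namespace Literature.Geometry.Kaehler

namespace ComplexTorus

/-! ## Intersection numbers read in the intersection ring: symmetry, `(λ_T · {D}^{·q})`, `(C · Θ) = g` -/

section Numbers

variable {ι : Type*} [Fintype ι] [DecidableEq ι] {E : Type*} [NormedAddCommGroup E] [NormedSpace ℂ E]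
  (Φ : (ι → ℝ) ≃L[ℝ] E)

omit [Fintype ι] in
/-- Integrating a reindexed top form: `∫_X θ.domDomCongr = ∫_X θ` (with the correspondingly reindexed
enumeration). [folklore] -/
private theorem torusIntegral_domDomCongr_finCongr {a b : ℕ} (h : a = b) (e' : Fin b ≃ ι)
    (θ : E [⋀^Fin a]→L[ℝ] ℂ) :
    torusIntegral Φ e' (θ.domDomCongr (finCongr h)) = torusIntegral Φ ((finCongr h).trans e') θ := by
  subst h; rfl

/-- **Graded symmetry of intersection numbers: `(τ · σ) = (-1)^{kl} (σ · τ)`** for `σ ∈ H_k(X, ℤ)`,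
`τ ∈ H_l(X, ℤ)`, `k + l = 2g` (graded commutativity of the cup product of the Poincaré duals; the
enumerations `e`, `e'` only fix the bookkeeping, `∫_X` and `P` do not depend on them).
[cite: Lange2023AbelianVarietiesComplex, §2.5.3 (intersection numbers, p. 134)] -/
theorem intersectionNumber_comm {k l : ℕ} (e : Fin (l + k) ≃ ι) (e' : Fin (k + l) ≃ ι)
    (σ : ⋀[ℤ]^k (ι → ℤ)) (τ : ⋀[ℤ]^l (ι → ℤ)) :
    intersectionNumber Φ e' τ σ = (-1 : ℂ) ^ (k * l) * intersectionNumber Φ e σ τ := by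
  rw [intersectionNumber, intersectionNumber,
    cyclePoincareDual_eq_of_orientation Φ e' ((finCongr (Nat.add_comm k l)).trans e),
    cyclePoincareDual_eq_of_orientation Φ ((finCongr (Nat.add_comm l k)).trans e') e,
    ContinuousAlternatingMap.WedgeComm_holds ℝ E ℂ, ← Complex.coe_smul, torusIntegral_smul,
    torusIntegral_domDomCongr_finCongr, torusIntegral_eq_torusIntegral Φ _ e, mul_comm l k]
  push_cast
  ring

variable {g : ℕ} {e₀ : Fin g ⊕ Fin g ≃ ι} {η : E [⋀^Fin 2]→L[ℝ] ℝ} {d : Fin g → ℕ}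

/-- **`(λ_{t₁} ⋆ μ_{t₁} ⋆ ⋯ ⋆ λ_{t_q} ⋆ μ_{t_q} · {D}^{·q}) = (-1)^q q! ∏ᵢ d_{tᵢ}`** — the intersection numbers
of the interleaved `2q`-cycles with the `q`-th intersection power of the divisor class, for a Riemann form
with a symplectic enumeration of type `d` (`q + p = g`; Lemma 2.5.15 is the case `q = 1`:
`(λᵢ ⋆ λ_{g+i} · {D}) = -dᵢ`). Proof: `∫_{λ_T} P({D}^{·q}) = ∫_{λ_T} ∧^q c₁(L) = (-1)^q η^{∧q}(λ_{t₁}, μ_{t₁}, …)`.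
[cite: Lange2023AbelianVarietiesComplex, §2.5.3 Lemma 2.5.15 and Thm. 2.5.16] -/
theorem IsSymplecticEnum.intersectionNumber_latCycle_ilvWord_intersectionPow
    (h : IsSymplecticEnum Φ e₀ η d) (hηNS : IsNSForm Φ η) {p q l : ℕ}
    (h2 : 2 * q + 2 * p = 2 * g) (hl : 2 + l = 2 * g) {t : Fin q → Fin g} (ht : Function.Injective t)
    (e : Fin (2 * p + 2 * q) ≃ ι) :
    intersectionNumber Φ e (latCycle (ilvWord e₀ t))
        (intersectionPow Φ (ilvEnum e₀) hl (divisorCycle Φ hηNS ((finCongr hl).trans (ilvEnum e₀))) q h2) =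
      (-1 : ℂ) ^ q * ((q.factorial : ℕ) * ∏ i, (d (t i) : ℂ)) := by
  rw [intersectionNumber_eq_cycleIntegral,
    cyclePoincareDual_eq_of_orientation Φ _ ((finCongr h2).trans (ilvEnum e₀)),
    cyclePoincareDual_intersectionPow, cyclePoincareDual_divisorCycle, ofRealForm_neg, wedgePow_neg,
    cycleIntegral_latCycle, ContinuousAlternatingMap.smul_apply, h.wedgePow_apply_ilvWord Φ ht, smul_eq_mul]
  push_cast
  ring

/-- **`(W · {D}) = Σ_ν d_ν²` for the class `W = -Σ_ν d_ν λ_ν ⋆ μ_ν`** (the class with the periods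
`∫_W dx_a ∧ dx_b = -E(λ_a, λ_b)` of a curve, `eq_neg_sum_smul_latCycle_pair_of_cycleIntegral`), by
Lemma 2.5.15 `(λ_ν ⋆ μ_ν · {D}) = -d_ν`. [cite: Lange2023AbelianVarietiesComplex, §2.5.3 Lemma 2.5.15 and §4.2 Cor. 4.2.3] -/
theorem IsSymplecticEnum.intersectionNumber_neg_sum_smul_latCycle_pair_divisorCycle
    (h : IsSymplecticEnum Φ e₀ η d) (hηNS : IsNSForm Φ η) {l : ℕ} (e : Fin (l + 2) ≃ ι) :
    intersectionNumber Φ e (-∑ ν, (d ν : ℤ) • latCycle ![e₀ (Sum.inl ν), e₀ (Sum.inr ν)])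
        (divisorCycle Φ hηNS ((finCongr (Nat.add_comm 2 l)).trans e)) = ∑ ν, (d ν : ℂ) ^ 2 := by
  rw [intersectionNumber_eq_cycleIntegral, map_neg, map_sum, LinearMap.neg_apply, LinearMap.sum_apply,
    ← Finset.sum_neg_distrib]
  refine Finset.sum_congr rfl fun ν _ ↦ ?_
  rw [map_zsmul, LinearMap.smul_apply, ← intersectionNumber_eq_cycleIntegral,
    (h.intersectionNumber_latCycle_divisorCycle Φ hηNS e ν ν).1, if_pos rfl, zsmul_eq_mul]
  push_cast
  ring

/-- **Corollary 4.2.3, `(C · Θ) = g`, at the level of the torus**: for a PRINCIPAL polarisation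
(`d = 1`) with a symplectic enumeration and any class `W ∈ H₂(X, ℤ)` with the periods of the curve class,
`∫_W dx_a ∧ dx_b = -E(λ_a, λ_b)` (so `W = -Σ_ν λ_ν ⋆ λ_{g+ν} = {W̃₁}`), the intersection number with the
theta divisor class is `(W · {Θ}) = g`. (Lange derives it from Poincaré's formula; here directly from
Lemma 2.5.15.) [cite: Lange2023AbelianVarietiesComplex, §4.2 Cor. 4.2.3] -/
theorem IsSymplecticEnum.intersectionNumber_divisorCycle_eq_of_cycleIntegral
    (h : IsSymplecticEnum Φ e₀ η 1) (hηNS : IsNSForm Φ η) {W : ⋀[ℤ]^2 (ι → ℤ)}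
    (hW : ∀ a b : ι, cycleIntegral Φ 2 W (latMonomial Φ 2 ![a, b]) =
      -(η ![Φ (Pi.single a 1), Φ (Pi.single b 1)] : ℂ)) {l : ℕ} (e : Fin (l + 2) ≃ ι) :
    intersectionNumber Φ e W (divisorCycle Φ hηNS ((finCongr (Nat.add_comm 2 l)).trans e)) = g := by
  rw [h.eq_neg_sum_smul_latCycle_pair_of_cycleIntegral Φ hW,
    h.intersectionNumber_neg_sum_smul_latCycle_pair_divisorCycle Φ hηNS e]
  simp

end Numbers

end ComplexTorus

end Literature.Geometry.Kaehler
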